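import Mathlib.GroupTheory.OrderOfElement
import Literature.NumberTheory.LFunctions.AutomaticSequenceTransducerArith3
import HarnessLib

/-!
# Arithmetic restrictions for the naturally induced transducer, IV: the residues `s` and `k₀` (Müllner 2017, Lemmas 2.20–2.21; proved)

Everything in this file is PROVED (plus plain definitions). It continues §2.4 of C. Müllner,
*Automatic sequences fulfill the Sarnak conjecture* (Duke Math. J. 166 (2017)) over the digit
alphabet (`k ≥ 2`, letters `≥ k` trivial), `d = transducerPeriod k δ`, `d' = transducerDPrime`:

* `MinImage.exists_uniform_stab` — one threshold `m` after which `d_{g,ℓ} = d(q,q̄)` for all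
  states, classes and outputs;
* `MinImage.natCast_wordVal_eq` — on such lengths the numbers `[w]_k` of paths with the same output
  are congruent modulo `d'` (Müllner's `s_ℓ^{q q̄}(g) = r_ℓ^{q q̄}(g) mod d'` is well defined);
  `MinImage.sVal hk htriv M M' g L ∈ ZMod d'` is that residue (`sVal_eq`);
* **Lemma 2.20** (`MinImage.sVal_add`): additivity
  `s^{q₁q₃}(g₁g₂, L₁+L₂) = s^{q₁q₂}(g₁, L₁) + s^{q₂q₃}(g₂, L₂)` when `d ∣ L₂`
  (`k^{L₂} ≡ 1 (mod d')`, `natCast_pow_eq_one_of_dvd`);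
* **Lemma 2.21** (`MinImage.exists_sVal_one_eq_nsmul`): the residues of the identity loops are
  linear in the length, `s^{qq}(id, dℓ) = ℓ • a_q` for `ℓ ≥ m`; hence they vanish exactly on the
  multiples of `k₀(q) := addOrderOf a_q` (`sVal_one_eq_zero_iff`).

Lemma 2.22 (the second relabelling), Prop. 2.23, Cor. 2.24 and the assembly Thm. 2.16 remain.

## References
* C. Müllner, Duke Math. J. 166 (2017), §2.4: definition of `s_ℓ^{q q̄}`, Lemmas 2.20, 2.21.
  [Mullner2017]
-/

noncomputable section

open Finset

namespace Literature.NumberTheory.LFunctions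

namespace MinImage

variable {σ : Type*} [Fintype σ] [DecidableEq σ] {δ : σ → ℕ → σ} {k : ℕ}

/-! ## Uniform stabilisation and the residues modulo `d'` -/

/-- **One stabilisation threshold for all states and classes** (Lemma 2.17's `m₀'`, "not
depending on `q, q̄`"). [cite: Mullner2017, Lemma 2.17] -/
theorem exists_uniform_stab (hk : 2 ≤ k) (htriv : ∀ q d, k ≤ d → δ q d = q) :
    ∃ m : ℕ, ∀ (M M' : MinImage δ) (c : ZMod (transducerPeriod k δ)) (g : Equiv.Perm (Fin (minRank δ))),
      g ∈ M.pathOutputs k M' c → ∀ K : ℕ, m ≤ K →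
        M.diffGcd k M' g (c.val + K * transducerPeriod k δ) = M.limitDiffGcd hk htriv M' c := by
  haveI : NeZero (transducerPeriod k δ) := ⟨(transducerPeriod_pos (by omega) htriv).ne'⟩
  choose m hm using fun (M M' : MinImage δ) (c : ZMod (transducerPeriod k δ)) =>
    M.exists_forall_diffGcd_eq_limitDiffGcd hk htriv M' c
  refine ⟨univ.sup fun t : MinImage δ × MinImage δ × ZMod (transducerPeriod k δ) => m t.1 t.2.1 t.2.2,
    fun M M' c g hg K hK => hm M M' c g hg K ?_⟩
  exact (le_sup (f := fun t : MinImage δ × MinImage δ × ZMod (transducerPeriod k δ) =>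
    m t.1 t.2.1 t.2.2) (mem_univ (M, M', c))).trans hK

/-- **The residue modulo `d'` of the number of a path is determined by its endpoints, length and
output** on stabilised lengths (Müllner: `s_ℓ^{q q̄}(g)` well defined). [cite: Mullner2017, §2.4 (definition of s_ℓ)] -/
theorem natCast_wordVal_eq (hk : 2 ≤ k) (htriv : ∀ q d, k ≤ d → δ q d = q)
    {M M' : MinImage δ} {c : ZMod (transducerPeriod k δ)} {g : Equiv.Perm (Fin (minRank δ))} {K : ℕ}
    (hstab : M.diffGcd k M' g (c.val + K * transducerPeriod k δ) = M.limitDiffGcd hk htriv M' c)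
    {x y : ℕ} (hx : x ∈ M.pathVals k M' g (c.val + K * transducerPeriod k δ))
    (hy : y ∈ M.pathVals k M' g (c.val + K * transducerPeriod k δ)) :
    (x : ZMod (transducerDPrime hk δ htriv)) = y := by
  have h := int_dvd_sub_of_mem_pathVals hx hy
  rw [hstab] at h
  have h' : (transducerDPrime hk δ htriv : ℤ) ∣ (x : ℤ) - y :=
    (Int.natCast_dvd_natCast.2 ((M.dPrime_eq_transducerDPrime hk htriv M' c) ▸
      M.dPrime_dvd_limitDiffGcd_self hk htriv M' c)).trans h
  have := (ZMod.intCast_eq_intCast_iff_dvd_sub (y : ℤ) (x : ℤ) (transducerDPrime hk δ htriv)).2 h'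
  push_cast at this
  exact this.symm

/-- `s_L^{q q̄}(g) ∈ ZMod d'`: the residue modulo `d'(A)` of the number `[w]_k` of any digit path of
length `L` from `M` to `M'` with output `g` (`0` if there is none; meaningful on stabilised
lengths). [cite: Mullner2017, §2.4 (definition of s_ℓ)] -/
def sVal (hk : 2 ≤ k) (htriv : ∀ q d, k ≤ d → δ q d = q) (M M' : MinImage δ)
    (g : Equiv.Perm (Fin (minRank δ))) (L : ℕ) : ZMod (transducerDPrime hk δ htriv) := by
  classical
  exact if h : ∃ w : List ℕ, (∀ d ∈ w, d < k) ∧ w.length = L ∧ M.next w = M' ∧ M.T w = g then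
    (wordVal k h.choose : ZMod (transducerDPrime hk δ htriv)) else 0

/-- **Characterisation of `s`**: on a stabilised length, `s_L^{q q̄}(g) = [w]_k mod d'` for EVERY
admissible path `w`. [cite: Mullner2017, §2.4 (definition of s_ℓ)] -/
theorem sVal_eq (hk : 2 ≤ k) (htriv : ∀ q d, k ≤ d → δ q d = q)
    {M M' : MinImage δ} {c : ZMod (transducerPeriod k δ)} {g : Equiv.Perm (Fin (minRank δ))} {K : ℕ}
    (hstab : M.diffGcd k M' g (c.val + K * transducerPeriod k δ) = M.limitDiffGcd hk htriv M' c)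
    {w : List ℕ} (hwd : ∀ d ∈ w, d < k) (hwl : w.length = c.val + K * transducerPeriod k δ)
    (hwn : M.next w = M') (hwT : M.T w = g) :
    M.sVal hk htriv M' g (c.val + K * transducerPeriod k δ) = wordVal k w := by
  classical
  have h : ∃ w : List ℕ, (∀ d ∈ w, d < k) ∧ w.length = c.val + K * transducerPeriod k δ ∧
      M.next w = M' ∧ M.T w = g := ⟨w, hwd, hwl, hwn, hwT⟩
  rw [sVal, dif_pos h]
  obtain ⟨h1, h2, h3, h4⟩ := h.choose_spec
  exact natCast_wordVal_eq hk htriv hstab ⟨_, h1, h2, h3, h4, rfl⟩ ⟨w, hwd, hwl, hwn, hwT, rfl⟩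

/-! ## Lemma 2.20: additivity -/

/-- `k^d ≡ 1 (mod d')`, hence `k^L ≡ 1 (mod d')` whenever `d ∣ L`. [cite: Mullner2017, Lemma 2.20 (proof)] -/
theorem natCast_pow_eq_one_of_dvd (hk : 2 ≤ k) (htriv : ∀ q d, k ≤ d → δ q d = q) {L : ℕ}
    (hL : transducerPeriod k δ ∣ L) : ((k ^ L : ℕ) : ZMod (transducerDPrime hk δ htriv)) = 1 := by
  obtain ⟨j, rfl⟩ := hL
  have h1 : ((k ^ transducerPeriod k δ : ℕ) : ZMod (transducerDPrime hk δ htriv)) = 1 := by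
    have hdvd := transducerDPrime_dvd hk δ htriv
    have hpos : 1 ≤ k ^ transducerPeriod k δ := Nat.one_le_pow _ _ (by omega)
    have : ((k ^ transducerPeriod k δ - 1 : ℕ) : ZMod (transducerDPrime hk δ htriv)) = 0 :=
      (ZMod.natCast_eq_zero_iff _ _).2 hdvd
    rw [Nat.cast_sub hpos, Nat.cast_one, sub_eq_zero] at this
    exact this
  rw [pow_mul, Nat.cast_pow, h1, one_pow]

/-- **Müllner 2017, Lemma 2.20 (additivity of the residues)**: for stabilised lengths `L₁` (class
`c₁`), `L₂` (class `0`, i.e. `d ∣ L₂`) and `L₁ + L₂` (class `c₁`),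
`s^{q₁q₃}(g₁ ≫ g₂, L₁+L₂) = s^{q₁q₂}(g₁, L₁) + s^{q₂q₃}(g₂, L₂)` — since
`[w₁w₂]_k = [w₁]_k k^{L₂} + [w₂]_k` and `k^{L₂} ≡ 1 (mod d')`. [cite: Mullner2017, Lemma 2.20] -/
theorem sVal_add (hk : 2 ≤ k) (htriv : ∀ q d, k ≤ d → δ q d = q)
    {M₁ M₂ M₃ : MinImage δ} {c₁ : ZMod (transducerPeriod k δ)}
    {g₁ g₂ : Equiv.Perm (Fin (minRank δ))} {K₁ K₂ : ℕ}
    (hstab₁ : M₁.diffGcd k M₂ g₁ (c₁.val + K₁ * transducerPeriod k δ) = M₁.limitDiffGcd hk htriv M₂ c₁)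
    (hstab₂ : M₂.diffGcd k M₃ g₂ ((0 : ZMod (transducerPeriod k δ)).val + K₂ * transducerPeriod k δ) =
      M₂.limitDiffGcd hk htriv M₃ 0)
    (hstab : M₁.diffGcd k M₃ (g₁.trans g₂) (c₁.val + (K₁ + K₂) * transducerPeriod k δ) =
      M₁.limitDiffGcd hk htriv M₃ c₁)
    {w₁ w₂ : List ℕ} (h₁d : ∀ d ∈ w₁, d < k) (h₁l : w₁.length = c₁.val + K₁ * transducerPeriod k δ)
    (h₁n : M₁.next w₁ = M₂) (h₁T : M₁.T w₁ = g₁)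
    (h₂d : ∀ d ∈ w₂, d < k) (h₂l : w₂.length = K₂ * transducerPeriod k δ)
    (h₂n : M₂.next w₂ = M₃) (h₂T : M₂.T w₂ = g₂) :
    M₁.sVal hk htriv M₃ (g₁.trans g₂) (c₁.val + (K₁ + K₂) * transducerPeriod k δ) =
      M₁.sVal hk htriv M₂ g₁ (c₁.val + K₁ * transducerPeriod k δ) +
        M₂.sVal hk htriv M₃ g₂ ((0 : ZMod (transducerPeriod k δ)).val + K₂ * transducerPeriod k δ) := by
  have h₂l' : w₂.length = (0 : ZMod (transducerPeriod k δ)).val + K₂ * transducerPeriod k δ := by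
    rw [ZMod.val_zero, zero_add]; exact h₂l
  rw [sVal_eq hk htriv hstab₁ h₁d h₁l h₁n h₁T, sVal_eq hk htriv hstab₂ h₂d h₂l' h₂n h₂T,
    sVal_eq hk htriv hstab (digits_append h₁d h₂d)
      (by rw [List.length_append, h₁l, h₂l]; ring)
      (by rw [next_append, h₁n, h₂n]) (by rw [T_append, h₁n, h₁T, h₂T]),
    wordVal_append, Nat.cast_add, Nat.cast_mul, h₂l,
    natCast_pow_eq_one_of_dvd hk htriv (dvd_mul_left _ _), mul_one]

/-! ## Lemma 2.21: the residues of the identity loops and `k₀` -/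

/-- **Müllner 2017, Lemma 2.21 (linearity of the identity-loop residues)**: there are `m` and
`a ∈ ZMod d'` with `s^{qq}(id, ℓ d) = ℓ • a` for all `ℓ ≥ m` (additivity, Lemma 2.20, forces
`f(m + j) = f(m) + j a` and `f(m) = m a`). [cite: Mullner2017, Lemma 2.21] -/
theorem exists_sVal_one_eq_nsmul (hk : 2 ≤ k) (htriv : ∀ q d, k ≤ d → δ q d = q) (M : MinImage δ) :
    ∃ m : ℕ, ∃ a : ZMod (transducerDPrime hk δ htriv), ∀ ℓ : ℕ, m ≤ ℓ →
      M.sVal hk htriv M 1 (ℓ * transducerPeriod k δ) = ℓ • a := by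
  have hk0 : 0 < k := by omega
  haveI : NeZero (transducerPeriod k δ) := ⟨(transducerPeriod_pos hk0 htriv).ne'⟩
  obtain ⟨ms, hms⟩ := exists_uniform_stab hk htriv (δ := δ)
  obtain ⟨mr, hmr⟩ := M.exists_forall_exists_loop_eq hk0 htriv
  have h1 : (1 : Equiv.Perm (Fin (minRank δ))) ∈ M.pathOutputs k M 0 :=
    mem_pathOutputs.2 ⟨[], by simp, by simp, M.next_nil, M.T_nil⟩
  set m := max ms mr with hm
  set f : ℕ → ZMod (transducerDPrime hk δ htriv) :=
    fun ℓ => M.sVal hk htriv M 1 (ℓ * transducerPeriod k δ) with hf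
  have hlen0 : ∀ K : ℕ, (0 : ZMod (transducerPeriod k δ)).val + K * transducerPeriod k δ =
      K * transducerPeriod k δ := fun K => by rw [ZMod.val_zero, zero_add]
  -- additivity `f (ℓ₁ + ℓ₂) = f ℓ₁ + f ℓ₂` for `ℓ₁, ℓ₂ ≥ m` (Lemma 2.20 with identity loops)
  have hadd : ∀ ℓ₁ ℓ₂ : ℕ, m ≤ ℓ₁ → m ≤ ℓ₂ → f (ℓ₁ + ℓ₂) = f ℓ₁ + f ℓ₂ := by
    intro ℓ₁ ℓ₂ hℓ₁ hℓ₂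
    obtain ⟨w₁, h₁d, h₁l, h₁n, h₁T⟩ := hmr ℓ₁ (le_of_max_le_right hℓ₁) 1 (Subgroup.one_mem _)
    obtain ⟨w₂, h₂d, h₂l, h₂n, h₂T⟩ := hmr ℓ₂ (le_of_max_le_right hℓ₂) 1 (Subgroup.one_mem _)
    have hs₁ := hms M M 0 1 h1 ℓ₁ (le_of_max_le_left hℓ₁)
    have hs₂ := hms M M 0 1 h1 ℓ₂ (le_of_max_le_left hℓ₂)
    have h11 : ((1 : Equiv.Perm (Fin (minRank δ))).trans (1 : Equiv.Perm (Fin (minRank δ)))) = 1 :=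
      rfl
    have hs := hms M M 0 ((1 : Equiv.Perm (Fin (minRank δ))).trans (1 : Equiv.Perm (Fin (minRank δ))))
      (h11 ▸ h1) (ℓ₁ + ℓ₂) ((le_of_max_le_left hℓ₁).trans (Nat.le_add_right _ _))
    have key := sVal_add hk htriv (c₁ := (0 : ZMod (transducerPeriod k δ))) hs₁ hs₂ hs h₁d
      (by rw [hlen0]; exact h₁l) h₁n h₁T h₂d h₂l h₂n h₂T
    rw [h11] at key
    simp only [hf, ZMod.val_zero, zero_add, add_mul] at key ⊢
    exact key
  -- Cauchy: `f (m + j) = f m + j a` with `a = f (m+1) - f m`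
  obtain ⟨a, ha⟩ : ∃ a : ZMod (transducerDPrime hk δ htriv), a = f (m + 1) - f m := ⟨_, rfl⟩
  have hg : ∀ j : ℕ, f (m + j) = f m + (j : ZMod (transducerDPrime hk δ htriv)) * a := by
    intro j
    induction j with
    | zero => simp
    | succ j ih =>
      have e1 := hadd (m + j) (m + 1) (Nat.le_add_right _ _) (Nat.le_add_right _ _)
      have e2 := hadd (m + (j + 1)) m (Nat.le_add_right _ _) le_rfl
      rw [show m + j + (m + 1) = m + (j + 1) + m by ring, e2] at e1
      -- `e1 : f (m + (j+1)) + f m = f (m + j) + f (m + 1)`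
      show f (m + (j + 1)) = f m + ((j + 1 : ℕ) : ZMod (transducerDPrime hk δ htriv)) * a
      push_cast
      linear_combination e1 + ih - ha
  -- `f m = m a` from `f (2m) = 2 f m`
  have hfm : f m = (m : ZMod (transducerDPrime hk δ htriv)) * a := by
    have e1 : f (m + m) = f m + f m := hadd m m le_rfl le_rfl
    rw [hg m] at e1
    linear_combination -e1
  refine ⟨m, a, fun ℓ hℓ => ?_⟩
  obtain ⟨j, rfl⟩ : ∃ j, ℓ = m + j := ⟨ℓ - m, by omega⟩
  show f (m + j) = (m + j) • a
  rw [hg j, hfm, nsmul_eq_mul]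
  push_cast
  ring

/-- **Müllner 2017, Lemma 2.21**: with `k₀(q) := addOrderOf a_q`, for `ℓ ≥ m`:
`s^{qq}(id, ℓd) = 0 ↔ k₀(q) ∣ ℓ`. [cite: Mullner2017, Lemma 2.21] -/
theorem sVal_one_eq_zero_iff (hk : 2 ≤ k) (htriv : ∀ q d, k ≤ d → δ q d = q) {M : MinImage δ}
    {m : ℕ} {a : ZMod (transducerDPrime hk δ htriv)}
    (h : ∀ ℓ : ℕ, m ≤ ℓ → M.sVal hk htriv M 1 (ℓ * transducerPeriod k δ) = ℓ • a) {ℓ : ℕ}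
    (hℓ : m ≤ ℓ) : M.sVal hk htriv M 1 (ℓ * transducerPeriod k δ) = 0 ↔ addOrderOf a ∣ ℓ := by
  rw [h ℓ hℓ, addOrderOf_dvd_iff_nsmul_eq_zero]

end MinImage

end Literature.NumberTheory.LFunctions
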